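import Summits.BirchSwinnertonDyer.BirchSwinnertonDyer.Theorems.BiquadraticEisensteinDescentHeegnerTwistCouplingInSupplyQuarticPartnerEuler
import HarnessLib

set_option linter.dupNamespace false -- `Summit.BirchSwinnertonDyer.BirchSwinnertonDyer.Theorems.…` (summit = sub)
set_option autoImplicit false

/-!
# Crux `HeegnerTwistCouplingInSupply` (stmt-BirchSwinnertonDyer-21381) — the quartic `j = 1728` corner, habitat H⁺ (`y² = x³ + p·x`), I:
# `S(0, r²pq²) = {1, p}` for `p ≡ 15 (mod 16)`, a partner prime `r ≡ 5 (mod 8)` with `(r/p) = −1`, and `q ≡ 3 (mod 8)`, `(q/p) = +1`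

Route `BiquadraticEisensteinDescent` (cell `pub/bsd-wall`, width seat `bsd-wall-cm-bed-w4` g13; `--supports` 21381, helper). The SECOND
quartic habitat: `W_p⁺ : y² = x³ + p·x` has `S(0,p) = {1,p}` and `S(0,−4p)` of order `4` exactly for `p ≡ 3, 15 (mod 16)` (Silverman X.6.2:
odd `2`-Selmer parity, the rank-one habitat). Numerics (crux memo QUARTIC-CORNER-w4g13.md v2): for `p ≡ 15 (mod 16)` the Heegner twist
`d = −rq` (`r ≡ 5`, `q ≡ 3 (mod 8)`, `(d/p) = +1`) is sharp IFF `(r/p) = −1` (then `(q/p) = +1`; partners `5, 13, 29, 37`: no exception),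
a simpler law than H⁻'s (no fourth powers: `(p/r) = (r/p) = −1` makes every reduced form at `r` anisotropic outright); `p ≡ 3 (mod 16)` needs
partners `r ≡ 1 (mod 8)` instead (not treated). This file: descent on the divisors of `b = r²pq²` for `W_p⁺^{(−rq)} : y² = x³ + r²pq²·x`,
★ `mem_selmer_pos_iff_plus`: `S(0, r²pq²) = {1, p}` — the eight negative classes die over `ℝ`, `q, pq` at `2` (no solutions modulo `16`:
`p ≡ 15`, `q ≡ 3, 11`, `r ≡ 5, 13 (mod 16)`), `r, rp, rq, rpq` at `p` (non-residues `r, rq², rq, rq`).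
§1 supplies the `2`-adic lemma modulo `16`, the residues mod `p`, and the anisotropy «`X² = p·Y² ⇒ X = Y = 0`» modulo `r`.

HONEST FRAMING: a typed sub-corner on one CM family (measure zero in «all CM `W`»); the crux (residual C⁺) is untouched; BSD is not proved
by any of this. THEOREMS ONLY. Supports stmt-BirchSwinnertonDyer-21381.
-/

noncomputable section

open scoped Classical

namespace Summit.BirchSwinnertonDyer.BirchSwinnertonDyer.Theorems.BiquadraticEisensteinDescentHeegnerTwistCouplingInSupplyQuarticPlusDescent

open Literature.NumberTheory.EllipticCurves Literature.NumberTheory.EllipticCurves.XCubeAddPX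
  Summit.BirchSwinnertonDyer.BirchSwinnertonDyer.Theorems.BiquadraticEisensteinDescentHeegnerTwistCouplingInSupplyQuarticTwistLocal
  Summit.BirchSwinnertonDyer.BirchSwinnertonDyer.Theorems.BiquadraticEisensteinDescentHeegnerTwistCouplingInSupplyQuarticTwistDescent

/-! ## §1 Tools: `2`-adic kills modulo `16`, residues mod `p`, anisotropy mod `r` -/

section Tools

/-- **The `2`-adic obstruction «no solutions modulo `16`»** for `w² = c u⁴ + c′ z⁴`. [cite: SilvermanAEC2009, proof of Prop. X.6.2(b)] -/
theorem not_isSoluble_two_of_zmod16 {c c' : ℤ}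
    (h : ∀ z t : ZMod (2 ^ 4), z ^ 2 ≠ (c : ZMod (2 ^ 4)) + (c' : ZMod (2 ^ 4)) * t ^ 4 ∧
      z ^ 2 ≠ (c : ZMod (2 ^ 4)) * t ^ 4 + (c' : ZMod (2 ^ 4))) :
    ¬ ((twoIsogenyQuartic 0 c c').map (Int.castRingHom ℚ_[2])).IsSoluble := by
  intro hsol
  rw [← BinaryQuartic.map_intCast_map_coe, BinaryQuartic.isSoluble_map_coe_iff] at hsol
  rcases hsol with ⟨t, z, he⟩ | ⟨t, z, he⟩
  · rw [eval_map_quartic_zero, one_pow, mul_one] at he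
    have hbar := congrArg (PadicInt.toZModPow 4) he
    simp only [map_pow, map_add, map_mul, eq_intCast, map_intCast] at hbar
    exact (h _ _).1 hbar
  · rw [eval_map_quartic_zero, one_pow, mul_one] at he
    have hbar := congrArg (PadicInt.toZModPow 4) he
    simp only [map_pow, map_add, map_mul, eq_intCast, map_intCast] at hbar
    exact (h _ _).2 hbar

/-- Casts modulo `16` from a residue. [folklore] -/
theorem natCast_zmod16_of_mod {n s : ℕ} (h : n % 16 = s) (hs : s < 16) : (n : ZMod 16) = (s : ZMod 16) :=
  (ZMod.natCast_eq_natCast_iff' n s 16).mpr (by rw [h, Nat.mod_eq_of_lt hs])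

variable {p q r : ℕ} [hp : Fact p.Prime] [hr : Fact r.Prime]

omit hr in
/-- For `p ≡ 7 (mod 8)`, `(q/p) = +1`, `(r/p) = −1`: seventeen non-residues mod `p` met in the two descents. [folklore] -/
theorem nonresidues_mod_p_plus (hp8 : p % 8 = 7) (hqp : q ≠ p) (hrp : r ≠ p) (hQ : q.Prime) (hR : r.Prime)
    (hsq : IsSquare ((q : ℤ) : ZMod p)) (hnr : ¬ IsSquare ((r : ℤ) : ZMod p)) :
    ¬ IsSquare (((r * q ^ 2 : ℤ)) : ZMod p) ∧ ¬ IsSquare (((r * q : ℤ)) : ZMod p) ∧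
    ¬ IsSquare (((-(4 * r ^ 2 * q ^ 2) : ℤ)) : ZMod p) ∧ ¬ IsSquare (((-(4 * r ^ 2 * q) : ℤ)) : ZMod p) ∧
    ¬ IsSquare (((2 * r : ℤ)) : ZMod p) ∧ ¬ IsSquare (((2 * r * q : ℤ)) : ZMod p) ∧
    ¬ IsSquare (((-(2 * r ^ 2 * q ^ 2) : ℤ)) : ZMod p) ∧ ¬ IsSquare (((-(2 * r ^ 2 * q) : ℤ)) : ZMod p) ∧
    ¬ IsSquare (((-1 : ℤ)) : ZMod p) ∧ ¬ IsSquare (((-(q : ℤ)) : ℤ) : ZMod p) ∧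
    ¬ IsSquare (((4 * r * q ^ 2 : ℤ)) : ZMod p) ∧ ¬ IsSquare (((4 * r * q : ℤ)) : ZMod p) ∧
    ¬ IsSquare (((-2 : ℤ)) : ZMod p) ∧ ¬ IsSquare (((-(2 * q) : ℤ)) : ZMod p) ∧
    ¬ IsSquare (((2 * r * q ^ 2 : ℤ)) : ZMod p) ∧ ¬ IsSquare ((((r : ℤ) * p * 0 + 2 * r * q : ℤ)) : ZMod p) ∧
    ¬ IsSquare ((r : ℤ) : ZMod p) := by
  have hP := hp.out
  have hm1 := not_isSquare_neg_one (p := p) (by omega)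
  have h2 := isSquare_two (p := p) hp8
  have hq0 : ((q : ℤ) : ZMod p) ≠ 0 := by
    intro h0
    have : (p : ℤ) ∣ q := (ZMod.intCast_zmod_eq_zero_iff_dvd q p).mp h0
    have : p ∣ q := by exact_mod_cast this
    exact hqp ((Nat.prime_dvd_prime_iff_eq hP hQ).mp this).symm
  have h20 : ((2 : ℤ) : ZMod p) ≠ 0 := by
    intro h0
    have : (p : ℤ) ∣ 2 := (ZMod.intCast_zmod_eq_zero_iff_dvd 2 p).mp h0
    have h' : p ∣ 2 := by exact_mod_cast this
    rcases (Nat.dvd_prime Nat.prime_two).mp h' with h | h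
    · exact hP.one_lt.ne' h
    · omega
  have hsq2 : ∀ x : ZMod p, IsSquare (x ^ 2) := fun x => ⟨x, sq x⟩
  have hq2 : IsSquare (((q : ℤ) : ZMod p) ^ 2) := hsq2 _
  have hq20 : (((q : ℤ) : ZMod p) ^ 2) ≠ 0 := pow_ne_zero 2 hq0
  have h4 : IsSquare ((4 : ℤ) : ZMod p) := ⟨2, by push_cast; norm_num⟩
  have h40 : ((4 : ℤ) : ZMod p) ≠ 0 := by
    have : ((4 : ℤ) : ZMod p) = ((2 : ℤ) : ZMod p) ^ 2 := by push_cast; norm_num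
    rw [this]; exact pow_ne_zero 2 h20
  have hm10 : ((-1 : ℤ) : ZMod p) ≠ 0 := by push_cast; exact neg_ne_zero.mpr one_ne_zero
  -- `−r²` is a non-residue (as `−1` is and `r² ≠ 0` is a square), so is `r`; build the products
  have hr0 : ((r : ℤ) : ZMod p) ≠ 0 := by
    intro h0
    have : (p : ℤ) ∣ r := (ZMod.intCast_zmod_eq_zero_iff_dvd r p).mp h0
    have : p ∣ r := by exact_mod_cast this
    exact hrp ((Nat.prime_dvd_prime_iff_eq hP hR).mp this).symm
  have hr2 : IsSquare (((r : ℤ) : ZMod p) ^ 2) := hsq2 _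
  have hr20 : (((r : ℤ) : ZMod p) ^ 2) ≠ 0 := pow_ne_zero 2 hr0
  have hrq : ¬ IsSquare (((r * q : ℤ)) : ZMod p) := by
    rw [show ((r * q : ℤ) : ZMod p) = ((r : ℤ) : ZMod p) * ((q : ℤ) : ZMod p) by push_cast; ring]
    exact not_isSquare_mul_of_isSquare hnr hsq hq0
  have hmq : ¬ IsSquare (((-(q : ℤ)) : ℤ) : ZMod p) := by
    rw [show (((-(q : ℤ)) : ℤ) : ZMod p) = ((-1 : ℤ) : ZMod p) * ((q : ℤ) : ZMod p) by push_cast; ring]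
    exact not_isSquare_mul_of_isSquare hm1 hsq hq0
  have hm4r2 : ¬ IsSquare (((-(4 * r ^ 2) : ℤ)) : ZMod p) := by
    rw [show ((-(4 * r ^ 2) : ℤ) : ZMod p) = ((-1 : ℤ) : ZMod p) * ((4 : ℤ) : ZMod p) * ((r : ℤ) : ZMod p) ^ 2 by push_cast; ring]
    exact not_isSquare_mul_of_isSquare (not_isSquare_mul_of_isSquare hm1 h4 h40) hr2 hr20
  have hm2 : ¬ IsSquare (((-2 : ℤ)) : ZMod p) := by
    rw [show ((-2 : ℤ) : ZMod p) = ((-1 : ℤ) : ZMod p) * ((2 : ℤ) : ZMod p) by push_cast; ring]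
    exact not_isSquare_mul_of_isSquare hm1 h2 h20
  have hm2r2 : ¬ IsSquare (((-(2 * r ^ 2) : ℤ)) : ZMod p) := by
    rw [show ((-(2 * r ^ 2) : ℤ) : ZMod p) = ((-2 : ℤ) : ZMod p) * ((r : ℤ) : ZMod p) ^ 2 by push_cast; ring]
    exact not_isSquare_mul_of_isSquare hm2 hr2 hr20
  have h2r : ¬ IsSquare (((2 * r : ℤ)) : ZMod p) := by
    rw [show ((2 * r : ℤ) : ZMod p) = ((r : ℤ) : ZMod p) * ((2 : ℤ) : ZMod p) by push_cast; ring]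
    exact not_isSquare_mul_of_isSquare hnr h2 h20
  have h4r : ¬ IsSquare (((4 * r : ℤ)) : ZMod p) := by
    rw [show ((4 * r : ℤ) : ZMod p) = ((r : ℤ) : ZMod p) * ((4 : ℤ) : ZMod p) by push_cast; ring]
    exact not_isSquare_mul_of_isSquare hnr h4 h40
  refine ⟨?_, hrq, ?_, ?_, h2r, ?_, ?_, ?_, hm1, hmq, ?_, ?_, hm2, ?_, ?_, ?_, hnr⟩
  · rw [show ((r * q ^ 2 : ℤ) : ZMod p) = ((r : ℤ) : ZMod p) * ((q : ℤ) : ZMod p) ^ 2 by push_cast; ring]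
    exact not_isSquare_mul_of_isSquare hnr hq2 hq20
  · rw [show ((-(4 * r ^ 2 * q ^ 2) : ℤ) : ZMod p) = ((-(4 * r ^ 2) : ℤ) : ZMod p) * ((q : ℤ) : ZMod p) ^ 2 by push_cast; ring]
    exact not_isSquare_mul_of_isSquare hm4r2 hq2 hq20
  · rw [show ((-(4 * r ^ 2 * q) : ℤ) : ZMod p) = ((-(4 * r ^ 2) : ℤ) : ZMod p) * ((q : ℤ) : ZMod p) by push_cast; ring]
    exact not_isSquare_mul_of_isSquare hm4r2 hsq hq0
  · rw [show ((2 * r * q : ℤ) : ZMod p) = ((2 * r : ℤ) : ZMod p) * ((q : ℤ) : ZMod p) by push_cast; ring]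
    exact not_isSquare_mul_of_isSquare h2r hsq hq0
  · rw [show ((-(2 * r ^ 2 * q ^ 2) : ℤ) : ZMod p) = ((-(2 * r ^ 2) : ℤ) : ZMod p) * ((q : ℤ) : ZMod p) ^ 2 by push_cast; ring]
    exact not_isSquare_mul_of_isSquare hm2r2 hq2 hq20
  · rw [show ((-(2 * r ^ 2 * q) : ℤ) : ZMod p) = ((-(2 * r ^ 2) : ℤ) : ZMod p) * ((q : ℤ) : ZMod p) by push_cast; ring]
    exact not_isSquare_mul_of_isSquare hm2r2 hsq hq0
  · rw [show ((4 * r * q ^ 2 : ℤ) : ZMod p) = ((4 * r : ℤ) : ZMod p) * ((q : ℤ) : ZMod p) ^ 2 by push_cast; ring]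
    exact not_isSquare_mul_of_isSquare h4r hq2 hq20
  · rw [show ((4 * r * q : ℤ) : ZMod p) = ((4 * r : ℤ) : ZMod p) * ((q : ℤ) : ZMod p) by push_cast; ring]
    exact not_isSquare_mul_of_isSquare h4r hsq hq0
  · rw [show ((-(2 * q) : ℤ) : ZMod p) = ((-2 : ℤ) : ZMod p) * ((q : ℤ) : ZMod p) by push_cast; ring]
    exact not_isSquare_mul_of_isSquare hm2 hsq hq0
  · rw [show ((2 * r * q ^ 2 : ℤ) : ZMod p) = ((2 * r : ℤ) : ZMod p) * ((q : ℤ) : ZMod p) ^ 2 by push_cast; ring]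
    exact not_isSquare_mul_of_isSquare h2r hq2 hq20
  · rw [show (((r : ℤ) * p * 0 + 2 * r * q : ℤ) : ZMod p) = ((2 * r : ℤ) : ZMod p) * ((q : ℤ) : ZMod p) by push_cast; ring]
    exact not_isSquare_mul_of_isSquare h2r hsq hq0

omit hp in
/-- **Anisotropy modulo the partner, H⁺ form**: if `p` is a non-residue mod `r`, then `X² = p·Y²` forces `X = Y = 0`; hence for a unit
`k` the forms `k²·p·x⁴ − … ` reduce: `p·(x²)² = (k·y²)²` and `(x²)² = p·(k·y²)²` both force `x = y = 0`. [folklore] -/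
theorem eq_zero_of_sq_eq_mul_sq (hnp : ¬ IsSquare ((p : ℤ) : ZMod r)) {X Y : ZMod r}
    (h : X ^ 2 = ((p : ℤ) : ZMod r) * Y ^ 2) : X = 0 ∧ Y = 0 := by
  by_cases hY : Y = 0
  · rw [hY, zero_pow two_ne_zero, mul_zero] at h
    exact ⟨pow_eq_zero_iff two_ne_zero |>.mp h, hY⟩
  · exfalso
    apply hnp
    refine ⟨X / Y, ?_⟩
    rw [← sq, div_pow, h, mul_div_assoc, div_self (pow_ne_zero 2 hY), mul_one]

end Tools

/-! ## §2 The side `S(0, r²pq²) = {1, p}` -/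

section SSide

variable {p q r : ℕ} [hp : Fact p.Prime] [hq : Fact q.Prime] [hr : Fact r.Prime]

omit hp hq hr in
/-- **The `2`-adic kills of the `S`-side** (`p ≡ 15 (mod 16)`, `q ≡ 3 (mod 8)`, `r ≡ 5 (mod 8)`; no solutions modulo `16`): the classes
`q` and `pq`. [cite: SilvermanAEC2009, proof of Prop. X.6.2(b)] -/
theorem two_adic_kills_plus (hp16 : p % 16 = 15) (hq8 : q % 8 = 3) (hr8 : r % 8 = 5) :
    ¬ ((twoIsogenyQuartic 0 (q : ℤ) (r ^ 2 * p * q)).map (Int.castRingHom ℚ_[2])).IsSoluble ∧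
    ¬ ((twoIsogenyQuartic 0 ((p : ℤ) * q) (r ^ 2 * q)).map (Int.castRingHom ℚ_[2])).IsSoluble := by
  have hp' : (p : ZMod 16) = 15 := by simpa using natCast_zmod16_of_mod hp16 (by norm_num)
  have hq' : (q : ZMod 16) = 3 ∨ (q : ZMod 16) = 11 := by
    rcases (show q % 16 = 3 ∨ q % 16 = 11 by omega) with h | h
    · exact Or.inl (by simpa using natCast_zmod16_of_mod h (by norm_num))
    · exact Or.inr (by simpa using natCast_zmod16_of_mod h (by norm_num))
  have hr' : (r : ZMod 16) = 5 ∨ (r : ZMod 16) = 13 := by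
    rcases (show r % 16 = 5 ∨ r % 16 = 13 by omega) with h | h
    · exact Or.inl (by simpa using natCast_zmod16_of_mod h (by norm_num))
    · exact Or.inr (by simpa using natCast_zmod16_of_mod h (by norm_num))
  refine ⟨not_isSoluble_two_of_zmod16 ?_, not_isSoluble_two_of_zmod16 ?_⟩ <;>
  · push_cast
    rw [hp']
    rcases hq' with hq' | hq' <;> rcases hr' with hr' | hr' <;> rw [hq', hr'] <;> decide

/-- ★ **`S(0, r²pq²) = {1, p}`** (H⁺): primes `p ≡ 15 (mod 16)`, `q ≡ 3 (mod 8)`, `r ≡ 5 (mod 8)`, `(q/p) = +1`, `(r/p) = −1`. Of the sixteen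
squarefree divisors of `r²pq²` the eight negative ones die over `ℝ`, `1` and `p` are the images of `O` and `T`, `q, pq` die at `2`, and
`r, rp, rq, rpq` at `p`. [cite: SilvermanAEC2009, Prop. X.4.9 and Prop. X.6.1] -/
theorem mem_selmer_pos_iff_plus (hp16 : p % 16 = 15) (hq8 : q % 8 = 3) (hr8 : r % 8 = 5)
    (hsq : IsSquare ((q : ℤ) : ZMod p)) (hnr : ¬ IsSquare ((r : ℤ) : ZMod p)) (d : ℤ) :
    d ∈ twoIsogenySelmerGroup 0 (r ^ 2 * p * q ^ 2 : ℤ) ↔ d = 1 ∨ d = (p : ℤ) := by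
  have hP := hp.out
  have hQ := hq.out
  have hR := hr.out
  have hqp : q ≠ p := by rintro rfl; omega
  have hrp : r ≠ p := by rintro rfl; omega
  have hp0 : (p : ℤ) ≠ 0 := by exact_mod_cast hP.ne_zero
  have hq0 : (q : ℤ) ≠ 0 := by exact_mod_cast hQ.ne_zero
  have hr0 : (r : ℤ) ≠ 0 := by exact_mod_cast hR.ne_zero
  have hbpos : (0 : ℤ) < r ^ 2 * p * q ^ 2 := by positivity
  have hb : (r ^ 2 * p * q ^ 2 : ℤ) ≠ 0 := hbpos.ne'
  have hpq : ¬ (p : ℤ) ∣ q := fun h => hqp (((Nat.prime_dvd_prime_iff_eq hP hQ).mp (by exact_mod_cast h))).symm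
  have hpr : ¬ (p : ℤ) ∣ r := fun h => hrp (((Nat.prime_dvd_prime_iff_eq hP hR).mp (by exact_mod_cast h))).symm
  have hpI : Prime (p : ℤ) := Nat.prime_iff_prime_int.mp hP
  have hnd : ∀ m : ℤ, ¬ (p : ℤ) ∣ m → ¬ (p : ℤ) ^ 2 ∣ (p : ℤ) * m := fun m hm => not_sq_dvd_mul_of_not_dvd hm
  have hnrq2 : ¬ (p : ℤ) ∣ r * q ^ 2 := fun h => by
    rcases hpI.dvd_or_dvd h with h | h
    · exact hpr h
    · exact hpq (hpI.dvd_of_dvd_pow h)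
  have hnrq : ¬ (p : ℤ) ∣ r * q := fun h => by
    rcases hpI.dvd_or_dvd h with h | h
    · exact hpr h
    · exact hpq h
  obtain ⟨hrq2, hrq, -, -, -, -, -, -, -, -, -, -, -, -, -, -, hnr'⟩ := nonresidues_mod_p_plus (hp8 := by omega) hqp hrp hQ hR hsq hnr
  haveI : Fact (Nat.Prime 2) := ⟨Nat.prime_two⟩
  obtain ⟨k1, k2⟩ := two_adic_kills_plus (p := p) (q := q) (r := r) hp16 hq8 hr8
  constructor
  · intro hd
    have hsqf := squarefree_of_mem_twoIsogenySelmerGroup hd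
    have hd0 : d ≠ 0 := hsqf.ne_zero
    have hdvd : d ∣ (r ^ 2 * p * q ^ 2 : ℤ) := dvd_of_mem_twoIsogenySelmerGroup hd
    have key : ∀ d' : ℤ, d * d' = (r ^ 2 * p * q ^ 2 : ℤ) → (twoIsogenyQuartic 0 d d').IsLocallySoluble :=
      fun d' hdd => isLocallySoluble_of_mem hd0 hdd hd
    rcases lt_or_gt_of_ne hd0 with hneg | hpos
    · exfalso
      obtain ⟨d', hd'⟩ := hdvd
      have hd'neg : d' < 0 := by
        rcases pos_and_pos_or_neg_and_neg_of_mul_pos (show 0 < d * d' by rw [← hd']; exact hbpos) with ⟨h1, -⟩ | ⟨-, h2⟩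
        · exact absurd h1 (not_lt.mpr hneg.le)
        · exact h2
      exact not_isSoluble_real_twoIsogenyQuartic_of_neg hneg hd'neg le_rfl (key d' hd'.symm).1
    have hdabs : d = (d.natAbs : ℤ) := (Int.natAbs_of_nonneg hpos.le).symm ▸ rfl
    rcases Summit.BirchSwinnertonDyer.BirchSwinnertonDyer.Theorems.BiquadraticEisensteinDescentHeegnerTwistCouplingInSupplyQuarticPartnerDescent.natAbs_eq_of_squarefree_dvd_partner
      (p := p) (q := q) (r := r) hsqf hdvd with
        h | h | h | h | h | h | h | h <;> rw [h] at hdabs <;> push_cast at hdabs <;> subst hdabs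
    · exact Or.inl rfl
    · -- d = r : dies at p
      refine absurd ((key (r * p * q ^ 2) (by ring)).2 p) ?_
      exact not_isSoluble_padic_of_dvd_right (c := (r : ℤ)) (c' := r * p * q ^ 2) ⟨r * q ^ 2, by ring⟩
        (by rw [show (r * p * q ^ 2 : ℤ) = p * (r * q ^ 2) by ring]; exact hnd _ hnrq2) hnr'
    · exact Or.inr rfl
    · -- d = rp : dies at p
      refine absurd ((key (r * q ^ 2) (by ring)).2 p) ?_
      exact not_isSoluble_padic_of_dvd_left (c := (r : ℤ) * p) (c' := r * q ^ 2) ⟨r, by ring⟩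
        (by rw [show ((r : ℤ) * p) = p * r by ring]; exact hnd r hpr) hrq2
    · -- d = q : dies at 2
      exact absurd ((key (r ^ 2 * p * q) (by ring)).2 2) k1
    · -- d = rq : dies at p
      refine absurd ((key (r * p * q) (by ring)).2 p) ?_
      exact not_isSoluble_padic_of_dvd_right (c := (r : ℤ) * q) (c' := r * p * q) ⟨r * q, by ring⟩
        (by rw [show (r * p * q : ℤ) = p * (r * q) by ring]; exact hnd _ hnrq) hrq
    · -- d = pq : dies at 2
      exact absurd ((key (r ^ 2 * q) (by ring)).2 2) k2
    · -- d = rpq : dies at p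
      refine absurd ((key (r * q) (by ring)).2 p) ?_
      exact not_isSoluble_padic_of_dvd_left (c := (r : ℤ) * (p * q)) (c' := r * q) ⟨r * q, by ring⟩
        (by rw [show ((r : ℤ) * (p * q)) = p * (r * q) by ring]; exact hnd _ hnrq) hrq
  · rintro (rfl | rfl)
    · exact one_mem_twoIsogenySelmerGroup 0 hb
    · refine mem_twoIsogenySelmerGroup_of_isSquare hb (Int.squarefree_natCast.mpr hP.prime.squarefree) ⟨r ^ 2 * q ^ 2, by ring⟩
        ⟨r * q, ?_⟩
      rw [show (r ^ 2 * p * q ^ 2 : ℤ) = (p : ℤ) * (r ^ 2 * q ^ 2) by ring, Int.mul_ediv_cancel_left _ hp0]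
      ring

end SSide

end Summit.BirchSwinnertonDyer.BirchSwinnertonDyer.Theorems.BiquadraticEisensteinDescentHeegnerTwistCouplingInSupplyQuarticPlusDescent

end
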